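import Literature.AlgebraicGeometry.Motives.SubschemeCyclesFlatPullbackRatProofs
import Literature.AlgebraicGeometry.Motives.SubschemeCyclesRatStalkProofs
import HarnessLib

/-!
# `A₀(𝔸¹_K) = 0`: every closed point of the affine line over a field is a principal divisor

Fulton, *Intersection Theory*, §1.9, p. 23: "In particular, `A_k(𝔸ⁿ)` is zero for `k < n`";
the case `n = 1`, `k = 0`, in the explicit form the tree's rational equivalence
(`Motives/Cycles`: `ratEquivGenerators`, `ratTrivial`, built on Mathlib's order of vanishing
`Scheme.ord`) asks for: for a field `K` and a closed point `z` of `𝔸¹_K = Spec K[X]`, with prime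
`𝔭_z = (π)`, `π` a prime polynomial,

* `ord_fn_eq_one` — **`ord_z(π) = 1`**: in `𝒪_{𝔸¹,z} = K[X]_{(π)}` the germ of `π` generates the
  maximal ideal (`span_germ_sec_eq_maximalIdeal`, through Mathlib's
  `IsAffineOpen.isLocalization_stalk` and `IsLocalization.AtPrime.map_eq_maximalIdeal`; the prime
  `primeIdealOf z ⊆ Γ(𝔸¹, 𝒪) ≅ K[X]` is `(π)`, `primeIdealOf_eq_span`), so Mathlib's
  `Ring.ord = ℓ(𝒪/π𝒪) = ℓ(κ(z)) = 1`;
* `ord_fn_eq_zero_of_notMem` — **`ord_y(π) = 0` for `π ∉ 𝔭_y`** (`π` is a unit on `D(π) ∋ y`,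
  Mathlib `Scheme.ord_of_isUnit`);
* `divFun_fn_eq_primeCycle` — hence **`[div_{𝔸¹} π] = [z]`** (Fulton §1.2–1.3: `[div(r)] =
  Σ ord_V(r) [V]`), and
* `primeCycle_mem_ratEquivGenerators`, `primeCycle_mem_ratTrivial` — **`[z] ∈ Rat₀(𝔸¹_K)` for
  every closed point `z`**, i.e. `A₀(𝔸¹_K) = 0` (the generic point being the only point of
  positive dimension).

The closed subvariety carrying `π` is `𝔸¹` itself (`FlatPullbackRatCounterexample.lineSelf` of
`Motives/SubschemeCyclesFlatPullbackRatProofs`, reused together with its dimension and the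
codimension of closed points). This is the base computation of the affine-bundle induction for
`A_k(𝔸ⁿ) = 0` (Fulton Prop. 1.9, proof: "let `r ∈ K[t]` generate `qK[t]`"): over the generic
fibre `𝔸¹_{K(X)}` of `𝔸¹ × X → X` the dominant subvariety `V` is such a closed point.
Everything is proved; the only definitions are the section `sec π ∈ Γ(𝔸¹, 𝒪)` and the rational
function `fn π ∈ K(X)` of a polynomial.

## References

* [Fulton1998] W. Fulton, *Intersection Theory*, 2nd ed. (1998): §1.2 (order of vanishing,
  `ord_V(r) = ℓ_A(A/(r))`), §1.3 (`[div(r)]`, `Rat_k`), §1.9 p. 23 and the proof of Prop. 1.9.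
-/

noncomputable section

universe u

open CategoryTheory AlgebraicGeometry Order Polynomial IsLocalRing TopologicalSpace

namespace Literature.AlgebraicGeometry.Motives

namespace AffineLineDivisor

open FlatPullbackRatCounterexample

variable (K : Type u) [Field K]

local notation "𝔸" => Spec (CommRingCat.of K[X])

variable {K}

/-- The global section of `𝔸¹_K` attached to a polynomial. [folklore] -/
def sec (π : K[X]) : Γ(𝔸, ⊤) := (Scheme.ΓSpecIso (CommRingCat.of K[X])).inv π

/-- Unfolding of `sec` (`rfl`). [folklore] -/
theorem sec_def (π : K[X]) : sec π = (Scheme.ΓSpecIso (CommRingCat.of K[X])).inv π := rfl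

/-- `Γ(𝔸¹, 𝒪) ≅ K[X]` takes `sec π` back to `π`. [folklore] -/
@[simp]
theorem ΓSpecIso_hom_sec (π : K[X]) : (Scheme.ΓSpecIso (CommRingCat.of K[X])).hom (sec π) = π := by
  rw [sec_def]
  exact Iso.inv_hom_id_apply _ _

/-- `sec` is multiplicative (it is a ring isomorphism). [folklore] -/
theorem sec_mul (π q : K[X]) : sec (π * q) = sec π * sec q := by
  simp only [sec_def, map_mul]

/-- Every global section is `sec` of a polynomial. [folklore] -/
theorem sec_ΓSpecIso_hom (s : Γ(𝔸, ⊤)) : sec ((Scheme.ΓSpecIso (CommRingCat.of K[X])).hom s) = s := by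
  rw [sec_def]
  exact Iso.hom_inv_id_apply _ _

/-- `sec π ≠ 0` for `π ≠ 0`. [folklore] -/
theorem sec_ne_zero {π : K[X]} (hπ : π ≠ 0) : sec π ≠ 0 := fun h ↦ hπ (by
  have h' := congrArg (Scheme.ΓSpecIso (CommRingCat.of K[X])).hom h
  rwa [ΓSpecIso_hom_sec, map_zero] at h')

/-- `y ∈ D(sec π) ↔ π ∉ 𝔭_y`. [folklore] -/
theorem mem_basicOpen_sec_iff (π : K[X]) (y : ↥𝔸) :
    y ∈ (𝔸).basicOpen (sec π) ↔ π ∉ y.asIdeal := by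
  rw [sec_def, basicOpen_eq_of_affine]
  exact Iff.rfl

/-- The rational function `π ∈ K(X) = K(𝔸¹)` of a polynomial. [folklore] -/
def fn (π : K[X]) : (𝔸).functionField := (𝔸).germToFunctionField ⊤ (sec π)

/-- Unfolding of `fn` (`rfl`). [folklore] -/
theorem fn_def (π : K[X]) : fn π = (𝔸).germToFunctionField ⊤ (sec π) := rfl

/-- `π ≠ 0` in `K(X)`. [folklore] -/
theorem fn_ne_zero {π : K[X]} (hπ : π ≠ 0) : fn π ≠ 0 := by
  rw [fn_def]
  exact (map_ne_zero_iff _ (Scheme.germToFunctionField_injective _ _)).mpr (sec_ne_zero hπ)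

/-- **`ord_y(π) = 0` off `V(π)`**: at a point whose prime does not contain `π`, the polynomial
`π` is a unit, so its order of vanishing is `0` (Mathlib `Scheme.ord_of_isUnit` on `D(π)`).
[folklore] -/
theorem ord_fn_eq_zero_of_notMem {π : K[X]} {y : ↥𝔸} (hy : π ∉ y.asIdeal) :
    Scheme.ord (fn π) y = 0 := by
  have hyU : y ∈ (𝔸).basicOpen (sec π) := (mem_basicOpen_sec_iff π y).mpr hy
  haveI : Nonempty ((𝔸).basicOpen (sec π)) := ⟨⟨y, hyU⟩⟩
  have hres : fn π = (𝔸).germToFunctionField ((𝔸).basicOpen (sec π))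
      ((𝔸).presheaf.map (homOfLE ((𝔸).basicOpen_le (sec π))).op (sec π)) := by
    rw [fn_def]
    change _ = ((𝔸).presheaf.map (homOfLE ((𝔸).basicOpen_le (sec π))).op ≫
      (𝔸).presheaf.germ _ (genericPoint _) _) (sec π)
    rw [TopCat.Presheaf.germ_res]
  rw [hres]
  have hunit : IsUnit ((𝔸).presheaf.map (homOfLE ((𝔸).basicOpen_le (sec π))).op (sec π)) :=
    (𝔸).toLocallyRingedSpace.toRingedSpace.isUnit_res_basicOpen (sec π)
  exact Scheme.ord_of_isUnit hunit hyU

section ClosedPoint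

variable {π : K[X]} {z : ↥(Spec (CommRingCat.of K[X]))}

/-- A closed point `V(π)` of `𝔸¹_K` (`π` prime) has a maximal prime ideal. [folklore] -/
theorem isMaximal_of_eq_span (hπ : Prime π) (hz : z.asIdeal = Ideal.span {π}) :
    z.asIdeal.IsMaximal :=
  IsPrime.to_maximal_ideal (by
    rw [hz, Ne, Ideal.span_singleton_eq_bot]
    exact hπ.ne_zero)

/-- A closed point `V(π)` of `𝔸¹_K` has codimension one. [folklore] -/
theorem coheight_eq_one_of_eq_span (hπ : Prime π) (hz : z.asIdeal = Ideal.span {π}) :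
    coheight z = 1 := by
  rw [← idealHeight_eq_coheight]
  haveI := isMaximal_of_eq_span hπ hz
  exact IsPrincipalIdealRing.height_eq_one_of_isMaximal _ Ideal.polynomial_not_isField

/-- The prime `primeIdealOf z ⊆ Γ(𝔸¹, 𝒪)` of the closed point `V(π)` is generated by `sec π`.
[folklore] -/
theorem primeIdealOf_eq_span (hz : z.asIdeal = Ideal.span {π}) :
    ((isAffineOpen_top 𝔸).primeIdealOf ⟨z, trivial⟩).asIdeal = Ideal.span {sec π} := by
  have key : ∀ s : Γ(𝔸, ⊤), s ∈ ((isAffineOpen_top 𝔸).primeIdealOf ⟨z, trivial⟩).asIdeal ↔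
      (Scheme.ΓSpecIso (CommRingCat.of K[X])).hom s ∈ z.asIdeal := by
    intro s
    rw [mem_primeIdealOf_iff, mem_maximalIdeal, mem_nonunits_iff,
      ← Scheme.mem_basicOpen (𝔸) s z trivial, ← sec_ΓSpecIso_hom s, mem_basicOpen_sec_iff,
      not_not, sec_ΓSpecIso_hom]
  ext s
  rw [key, hz, Ideal.mem_span_singleton, Ideal.mem_span_singleton]
  constructor
  · rintro ⟨q, hq⟩
    refine ⟨sec q, ?_⟩
    rw [← sec_ΓSpecIso_hom s, hq, sec_mul]
  · rintro ⟨q, hq⟩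
    refine ⟨(Scheme.ΓSpecIso (CommRingCat.of K[X])).hom q, ?_⟩
    rw [hq, map_mul, ΓSpecIso_hom_sec]

/-- **In the local ring `𝒪_{𝔸¹, V(π)}` the germ of `π` generates the maximal ideal**
(`𝒪_{𝔸¹,z} = K[X]_{(π)}`, Mathlib `IsAffineOpen.isLocalization_stalk` and
`IsLocalization.AtPrime.map_eq_maximalIdeal`). [folklore] -/
theorem span_germ_sec_eq_maximalIdeal (hz : z.asIdeal = Ideal.span {π}) :
    Ideal.span {((𝔸).presheaf.germ ⊤ z trivial).hom (sec π)} =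
      maximalIdeal ((𝔸).presheaf.stalk z) := by
  letI := TopCat.Presheaf.algebra_section_stalk (𝔸).presheaf (⟨z, trivial⟩ : (⊤ : (𝔸).Opens))
  haveI := (isAffineOpen_top 𝔸).isLocalization_stalk ⟨z, trivial⟩
  have h := IsLocalization.AtPrime.map_eq_maximalIdeal
    ((isAffineOpen_top 𝔸).primeIdealOf ⟨z, trivial⟩).asIdeal ((𝔸).presheaf.stalk z)
  rw [primeIdealOf_eq_span hz, Ideal.map_span, Set.image_singleton] at h
  exact h

/-- **`ord_{V(π)}(π) = 1`**: `𝒪/(π) = κ` has length one (Mathlib `Ring.ord`, `Module.length_eq_one`).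
[cite: Fulton1998, §1.2] -/
theorem ord_fn_eq_one (hπ : Prime π) (hz : z.asIdeal = Ideal.span {π}) :
    Scheme.ord (fn π) z = 1 := by
  have hco := coheight_eq_one_of_eq_span hπ hz
  haveI : Ring.KrullDimLE 1 ((𝔸).presheaf.stalk z) := krullDimLE_of_coheight_le hco.le
  set r := ((𝔸).presheaf.germ ⊤ z trivial).hom (sec π) with hr
  have hr0 : r ≠ 0 :=
    (map_ne_zero_iff _ (germ_injective_of_isIntegral _ (U := ⊤) z trivial)).mpr
      (sec_ne_zero hπ.ne_zero)
  have hr0' := mem_nonZeroDivisors_of_ne_zero hr0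
  -- `Ring.ord 𝒪_z r = ℓ(𝒪_z / r 𝒪_z) = ℓ(𝒪_z / 𝔪) = 1`
  have hord1 : Ring.ord ((𝔸).presheaf.stalk z) r = 1 := by
    rw [Ring.ord, hr, span_germ_sec_eq_maximalIdeal hz]
    haveI : IsSimpleModule ((𝔸).presheaf.stalk z)
        (((𝔸).presheaf.stalk z) ⧸ maximalIdeal ((𝔸).presheaf.stalk z)) :=
      isSimpleModule_iff_quot_maximal.mpr ⟨_, maximalIdeal.isMaximal _, ⟨LinearEquiv.refl _ _⟩⟩
    exact Module.length_eq_one _ _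
  have hordHom : Scheme.ordHom z hco (fn π) = Multiplicative.ofAdd (1 : ℤ) := by
    have e1 : Scheme.ordHom z hco (fn π) =
        Ring.ordFrac ((𝔸).presheaf.stalk z) (algebraMap _ (𝔸).functionField r) := by
      rw [hr, Scheme.algebraMap_germ_eq_germToFunctionField, fn_def]
      rfl
    rw [e1, Ring.ordFrac_eq_ord _ hr0, Ring.ordMonoidWithZeroHom_eq_coe _ hr0' (n := 1)
      (by rw [hord1]; rfl)]
    rfl
  exact (Scheme.ord_eq_iff hco (fn_ne_zero hπ.ne_zero)).mpr hordHom

end ClosedPoint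

/-! ### Every closed point of `𝔸¹_K` is a principal divisor -/

/-- The prime of a closed point of `𝔸¹_K` is generated by a prime polynomial (`K[X]` is a
principal ideal domain). [folklore] -/
theorem exists_prime_eq_span {z : ↥𝔸} (hz : z.asIdeal ≠ ⊥) :
    ∃ π : K[X], Prime π ∧ z.asIdeal = Ideal.span {π} := by
  set π := Submodule.IsPrincipal.generator z.asIdeal with hπdef
  have hπ : Ideal.span {π} = z.asIdeal := Ideal.span_singleton_generator _
  have hπ0 : π ≠ 0 := by
    intro h0
    apply hz
    rw [← hπ, h0]
    simp
  refine ⟨π, (Ideal.span_singleton_prime hπ0).mp ?_, hπ.symm⟩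
  rw [hπ]
  exact z.isPrime

/-- **`div_{𝔸¹}(π) = [V(π)]`**: the principal divisor of a prime polynomial `π` on the affine line
is the closed point it cuts out, with multiplicity one (`ord_{V(π)} π = 1`, `ord_y π = 0`
elsewhere). [cite: Fulton1998, §1.2 and §1.3] -/
theorem divFun_fn_eq_primeCycle {π : K[X]} (hπ : Prime π) {z : ↥𝔸}
    (hz : z.asIdeal = Ideal.span {π}) :
    (lineSelf K).divFun (fn π) = ⇑(primeCycle z) := by
  ext y
  have h1 : (lineSelf K).divFun (fn π) y = Scheme.ord (fn π) y := (lineSelf K).divFun_ι_base (fn π) y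
  rw [h1]
  by_cases hyz : y = z
  · subst hyz
    rw [primeCycle_apply_self]
    exact ord_fn_eq_one hπ hz
  · rw [primeCycle_apply_of_ne hyz]
    apply ord_fn_eq_zero_of_notMem
    intro hπy
    apply hyz
    have hle : z.asIdeal ≤ y.asIdeal := by
      rw [hz]
      exact (Ideal.span_singleton_le_iff_mem _).mpr hπy
    exact (PrimeSpectrum.ext ((isMaximal_of_eq_span hπ hz).eq_of_le y.isPrime.ne_top hle)).symm

/-- **`A₀(𝔸¹_K) = 0`, generator-wise: every closed point of the affine line over a field is a
principal divisor** — `[z] = [div_{𝔸¹} π] ∈ Rat₀(𝔸¹_K)` for the prime polynomial `π` with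
`𝔭_z = (π)` (Fulton, *Intersection Theory*, §1.9: "`A_k(𝔸ⁿ)` is zero for `k < n`", the case
`n = 1`; Example 1.3.1). [cite: Fulton1998, §1.9 (p. 23)] -/
theorem primeCycle_mem_ratEquivGenerators {z : ↥𝔸} (hz : z.asIdeal ≠ ⊥) :
    primeCycle z ∈ ratEquivGenerators 𝔸 0 := by
  obtain ⟨π, hπ, hzπ⟩ := exists_prime_eq_span hz
  refine ⟨primeCycle_mem_cyclesOfDim ?_, lineSelf K, inferInstance, fn π, fn_ne_zero hπ.ne_zero,
    ?_, (divFun_fn_eq_primeCycle hπ hzπ).symm⟩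
  · rw [Nat.cast_zero, Order.height_eq_zero]
    exact isMin_of_coheight_eq_one K (coheight_eq_one_of_eq_span hπ hzπ)
  · rw [lineSelf_dim, Nat.cast_zero, zero_add]

/-- **`A₀(𝔸¹_K) = 0`: every closed point of `𝔸¹_K` is rationally equivalent to zero.**
[cite: Fulton1998, §1.9 (p. 23)] -/
theorem primeCycle_mem_ratTrivial {z : ↥𝔸} (hz : z.asIdeal ≠ ⊥) :
    primeCycle z ∈ ratTrivial 𝔸 0 :=
  AddSubgroup.subset_closure (primeCycle_mem_ratEquivGenerators hz)

end AffineLineDivisor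

end Literature.AlgebraicGeometry.Motives

end
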